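import Mathlib
import HarnessLib
import Summits.Ventures.LatticeQCDFlow.Scoring.DoeblinPowerBatchMeansCLT
import Summits.Ventures.LatticeQCDFlow.Scoring.DoeblinPowerBatchMeansTauInt
import Summits.Ventures.LatticeQCDFlow.Exactness.SUNWilsonHMCErgodic
import Summits.Ventures.LatticeQCDFlow.Scoring.SUNMultiStepLeapfrogHMCBatchMeans
import Summits.Ventures.LatticeQCDFlow.Exactness.CabibboMarinariORSweep

/-!
# THE ENGINE'S `SU(N)` HMC AS RUN — its own Wilson force, trajectory length below the volume-uniform threshold:
# consistent batch-means error bars and asymptotically exact coverage from ANY start, on EVERY torus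

HONEST FRAMING: exact (Metropolis-corrected) sampling algorithms for lattice gauge theory;
figures of merit are autocorrelation/cost numbers at stated couplings and volumes; no
continuum-physics claim.

Venture `LatticeQCDFlow` (cell pub-lqcd), topic `Scoring`; FANOUT row 21 (`su3-base`, arm `E2 = PBC-HMC`: the row
REPORTS time averages of the plaquette / `Q²` / `t²E` along the engine's multi-step HMC with batch-means (Γ-method)
error bars).  NEW WORK of the cell, not a published result; no definition is introduced; nothing is cited as a fact.
The instance of row 21's `Scoring/SUNMultiStepLeapfrogHMCBatchMeans.lean` (any bounded Lipschitz increment) at the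
engine's OWN increment `−(ε/2)·sunWilsonForce N β` (`Exactness/SUNWilsonHMCForce.lean`: bounded by `sunWilsonForceSup`,
`sunWilsonForceLip`-Lipschitz, constants free of `L`) under the volume-uniform condition `nε ≤ sunWilsonTrajThreshold N d β`
of `Exactness/SUNWilsonHMCErgodic.lean` (`trajLength_threshold_arith` turns it into row 9's three conditions).

* `halfKick_sunWilsonForce_nonneg`, `norm_halfKick_sunWilsonForce_le`, `norm_halfKick_sunWilsonForce_sub_le` — the
  half kick meets the kernel hypotheses with `b = (ε/2)·F_sup`, `K_g = (ε/2)·K_F`;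
* **`wilsonForce_sunLeapfrogHMCN_batchMeans_tendstoInMeasure`** — `G = SU(N)`, defining representation, any real `β`,
  every torus `(ℤ/L)^d`, every `n ≥ 1`, `ε > 0` with `nε ≤ τ₀(N, d, β)`, every bounded measurable observable `f`, EVERY
  initial law: the batch-means estimator `a b · SE²_BM` converges in probability to the Green–Kubo variance `σ²_f` of
  `f` under `wilsonMeasure (suRep N) β` and the chain (`a, b → ∞`);
* **`wilsonForce_sunLeapfrogHMCN_batchMeans_coverage`** — when `σ²_f > 0`, the studentised interval
  `f̄ ± z·σ̂_BM/√N'` has asymptotic coverage `P(|N(0,1)| ≤ z)`.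

NOT CLAIMED: `σ²_f > 0`; any rate; anything beyond the threshold (the engine's usual `τ ≈ 1`); the Γ-method's
automatic window (row 16 / row 8 files); floating point.
-/

noncomputable section

namespace Summit.Ventures.LatticeQCDFlow.Scoring

open MeasureTheory ProbabilityTheory Filter Finset Preorder Literature.Probability.MarkovChains
open Literature.MathematicalPhysics.QuantumFieldTheory
open Summit.Ventures.LatticeQCDFlow.Exactness
open scoped ENNReal Topology Matrix Matrix.Norms.Operator

set_option backward.isDefEq.respectTransparency false

/-! ## The half kick of the engine's own force meets the kernel hypotheses -/

section HalfKick

variable (N : ℕ) [NeZero N] (d : ℕ) {L : ℕ} [NeZero L] (β : ℝ) {ε : ℝ}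

omit [NeZero N] [NeZero L] in
/-- `0 ≤ (ε/2)·F_sup`. -/
theorem halfKick_sunWilsonForce_nonneg (hε : 0 < ε) : 0 ≤ ε / 2 * sunWilsonForceSup N d β :=
  mul_nonneg (by positivity) (sunWilsonForceSup_nonneg N d β)

omit [NeZero N] [NeZero L] in
/-- `0 ≤ (ε/2)·K_F`. -/
theorem halfKickLip_sunWilsonForce_nonneg (hε : 0 < ε) : 0 ≤ ε / 2 * sunWilsonForceLip N d β :=
  mul_nonneg (by positivity) (sunWilsonForceLip_nonneg N d β)

omit [NeZero L] in
/-- The half kick `−(ε/2)·F` is bounded by `(ε/2)·F_sup` per link. -/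
theorem norm_halfKick_sunWilsonForce_le (hε : 0 < ε)
    (U : GaugeConfig d L (Matrix.specialUnitaryGroup (Fin N) ℂ)) (e : Edge d L) :
    ‖((-(ε / 2)) • sunWilsonForce N β U) e‖ ≤ ε / 2 * sunWilsonForceSup N d β := by
  rw [Pi.smul_apply, norm_smul, Real.norm_eq_abs, abs_neg, abs_of_pos (by positivity)]
  exact mul_le_mul_of_nonneg_left (norm_sunWilsonForce_le N β U e) (by positivity)

/-- The half kick is `(ε/2)·K_F`-Lipschitz in the matrix sup norm. -/
theorem norm_halfKick_sunWilsonForce_sub_le (hε : 0 < ε)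
    (U U' : GaugeConfig d L (Matrix.specialUnitaryGroup (Fin N) ℂ)) :
    ‖(-(ε / 2)) • sunWilsonForce N β U - (-(ε / 2)) • sunWilsonForce N β U'‖
      ≤ ε / 2 * sunWilsonForceLip N d β * ‖coeConfig U - coeConfig U'‖ := by
  have hsub : (-(ε / 2)) • sunWilsonForce N β U - (-(ε / 2)) • sunWilsonForce N β U' =
      (-(ε / 2)) • (sunWilsonForce N β U - sunWilsonForce N β U') := by rw [smul_sub]
  rw [hsub, norm_smul, Real.norm_eq_abs, abs_neg, abs_of_pos (by positivity), mul_assoc]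
  exact mul_le_mul_of_nonneg_left (norm_sunWilsonForce_sub_le N β U U') (by positivity)

end HalfKick


/-! ## The Wilson action with the engine's own force -/

section Wilson

variable (N : ℕ) [NeZero N] (d : ℕ) {L : ℕ} {ε : ℝ} {nstep : ℕ}

/-- **THE ENGINE'S `SU(N)` HMC AS RUN (its own Wilson force, `nε ≤ τ₀(N, d, β)`): BATCH MEANS ARE
CONSISTENT FOR `σ²_f`, FROM EVERY START, ON EVERY TORUS** (continuous `ρ`, any `β`, step `ε > 0`, any measurable momentum increment bounded by
`b ≥ 0`, `|f| ≤ C` measurable, `a, b → ∞`). -/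
theorem wilsonForce_sunLeapfrogHMCN_batchMeans_tendstoInMeasure [NeZero L] (β : ℝ) (hε : 0 < ε) (hn : 1 ≤ nstep)
    (hτ : nstep * ε ≤ sunWilsonTrajThreshold N d β)
    {f : GaugeConfig d L (Matrix.specialUnitaryGroup (Fin N) ℂ) → ℝ} (hf : Measurable f) {C : ℝ}
    (hC : ∀ U, |f U| ≤ C) (μ₀ : Measure (GaugeConfig d L (Matrix.specialUnitaryGroup (Fin N) ℂ)))
    [IsProbabilityMeasure μ₀] {a b' : ℕ → ℕ} (ha : Tendsto a atTop atTop) (hb' : Tendsto b' atTop atTop)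
    [hK : IsMarkovKernel (sunLeapfrogHMCN (sunCoordι N) (sunCoordι_skew N) ε
      (Measure.addHaar : Measure (SUNCoords N)) (sunKinetic N) (measurable_halfKick_sun N (measurable_sunWilsonForce N (d := d) (L := L) β) ε) (fun U => β * wilsonAction (suRep N) U) nstep)] :
    TendstoInMeasure (Kernel.trajMeasure
        (X := fun _ : ℕ => GaugeConfig d L (Matrix.specialUnitaryGroup (Fin N) ℂ)) μ₀
        (fun t : ℕ => (sunLeapfrogHMCN (sunCoordι N) (sunCoordι_skew N) ε
            (Measure.addHaar : Measure (SUNCoords N)) (sunKinetic N) (measurable_halfKick_sun N (measurable_sunWilsonForce N (d := d) (L := L) β) ε)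
            (fun U => β * wilsonAction (suRep N) U) nstep).comap
          (fun h : (i : ↥(Finset.Iic t)) → GaugeConfig d L (Matrix.specialUnitaryGroup (Fin N) ℂ) =>
            h ⟨t, Finset.mem_Iic.2 le_rfl⟩) (measurable_pi_apply _)))
      (fun (N' : ℕ) (x : ℕ → GaugeConfig d L (Matrix.specialUnitaryGroup (Fin N) ℂ)) =>
        ((b' N' * a N' : ℕ) : ℝ)
        * replicaSEsq (fun j (x : ℕ → GaugeConfig d L (Matrix.specialUnitaryGroup (Fin N) ℂ)) =>
            (∑ i ∈ Finset.range (b' N'), f (x (b' N' * j + i))) / (b' N')) (a N') x)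
      atTop (fun _ =>
        (∫ y, (f y - ∫ z, f z ∂(wilsonMeasure (d := d) (L := L) (suRep N) β)) ^ 2 ∂(wilsonMeasure (d := d) (L := L) (suRep N) β))
        + 2 * ∑' j, ∫ y, (f y - ∫ z, f z ∂(wilsonMeasure (d := d) (L := L) (suRep N) β))
          * (kop (sunLeapfrogHMCN (sunCoordι N) (sunCoordι_skew N) ε
              (Measure.addHaar : Measure (SUNCoords N)) (sunKinetic N) (measurable_halfKick_sun N (measurable_sunWilsonForce N (d := d) (L := L) β) ε)
              (fun U => β * wilsonAction (suRep N) U) nstep))^[j + 1]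
            (fun y => f y - ∫ z, f z ∂(wilsonMeasure (d := d) (L := L) (suRep N) β)) y
          ∂(wilsonMeasure (d := d) (L := L) (suRep N) β)) := by
  obtain ⟨h1, h2, h3⟩ := trajLength_threshold_arith (sunShortTrajThreshold_pos (sunCoordι N) (sunCoordι_injective N))
    (sunWilsonForceSup_nonneg N d β) (sunWilsonForceLip_nonneg N d β) hn hε (rfl : sunWilsonTrajThreshold N d β = _) hτ
  exact wilson_sunLeapfrogHMCN_batchMeans_tendstoInMeasure N (suRep N) continuous_suRep β hε hn
    (measurable_halfKick_sun N (measurable_sunWilsonForce N β) ε) (halfKick_sunWilsonForce_nonneg N d β hε)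
    (norm_halfKick_sunWilsonForce_le N d β hε) (halfKickLip_sunWilsonForce_nonneg N d β hε)
    (norm_halfKick_sunWilsonForce_sub_le N d β hε) h1 h2 h3 hf hC μ₀ ha hb'

/-- **THE ENGINE'S `SU(N)` HMC FOR THE WILSON ACTION: THE BATCH-MEANS INTERVAL IS ASYMPTOTICALLY
EXACT** (`σ²_f > 0`, `z > 0`, any start): `P_{μ₀}(|√N' (f̄_{N'} − ⟨f⟩_β)| ≤ z σ̂_BM) → (gaussianReal 0 1)[−z, z]`. -/
theorem wilsonForce_sunLeapfrogHMCN_batchMeans_coverage [NeZero L] (β : ℝ) (hε : 0 < ε) (hn : 1 ≤ nstep)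
    (hτ : nstep * ε ≤ sunWilsonTrajThreshold N d β)
    {f : GaugeConfig d L (Matrix.specialUnitaryGroup (Fin N) ℂ) → ℝ} (hf : Measurable f) {C : ℝ}
    (hC : ∀ U, |f U| ≤ C)
    (hσ : 0 < (∫ y, (f y - ∫ z, f z ∂(wilsonMeasure (d := d) (L := L) (suRep N) β)) ^ 2
          ∂(wilsonMeasure (d := d) (L := L) (suRep N) β))
        + 2 * ∑' j, ∫ y, (f y - ∫ z, f z ∂(wilsonMeasure (d := d) (L := L) (suRep N) β))
          * (kop (sunLeapfrogHMCN (sunCoordι N) (sunCoordι_skew N) ε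
              (Measure.addHaar : Measure (SUNCoords N)) (sunKinetic N) (measurable_halfKick_sun N (measurable_sunWilsonForce N (d := d) (L := L) β) ε)
              (fun U => β * wilsonAction (suRep N) U) nstep))^[j + 1]
            (fun y => f y - ∫ z, f z ∂(wilsonMeasure (d := d) (L := L) (suRep N) β)) y
          ∂(wilsonMeasure (d := d) (L := L) (suRep N) β))
    (μ₀ : Measure (GaugeConfig d L (Matrix.specialUnitaryGroup (Fin N) ℂ))) [IsProbabilityMeasure μ₀]
    {a b' : ℕ → ℕ} (ha : Tendsto a atTop atTop) (hb' : Tendsto b' atTop atTop) {z : ℝ} (hz : 0 < z)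
    [hK : IsMarkovKernel (sunLeapfrogHMCN (sunCoordι N) (sunCoordι_skew N) ε
      (Measure.addHaar : Measure (SUNCoords N)) (sunKinetic N) (measurable_halfKick_sun N (measurable_sunWilsonForce N (d := d) (L := L) β) ε) (fun U => β * wilsonAction (suRep N) U) nstep)] :
    Tendsto (fun N' : ℕ => (Kernel.trajMeasure
        (X := fun _ : ℕ => GaugeConfig d L (Matrix.specialUnitaryGroup (Fin N) ℂ)) μ₀
        (fun t : ℕ => (sunLeapfrogHMCN (sunCoordι N) (sunCoordι_skew N) ε
            (Measure.addHaar : Measure (SUNCoords N)) (sunKinetic N) (measurable_halfKick_sun N (measurable_sunWilsonForce N (d := d) (L := L) β) ε)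
            (fun U => β * wilsonAction (suRep N) U) nstep).comap
          (fun h : (i : ↥(Finset.Iic t)) → GaugeConfig d L (Matrix.specialUnitaryGroup (Fin N) ℂ) =>
            h ⟨t, Finset.mem_Iic.2 le_rfl⟩) (measurable_pi_apply _))).real
      {x | |((Real.sqrt ((b' N' * a N' : ℕ) : ℝ))⁻¹
          * ∑ t ∈ Finset.range (b' N' * a N'),
            (f (x t) - ∫ z, f z ∂(wilsonMeasure (d := d) (L := L) (suRep N) β)))
        / Real.sqrt (((b' N' * a N' : ℕ) : ℝ)
          * replicaSEsq (fun j (x : ℕ → GaugeConfig d L (Matrix.specialUnitaryGroup (Fin N) ℂ)) =>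
              (∑ i ∈ Finset.range (b' N'), f (x (b' N' * j + i))) / (b' N')) (a N') x)| ≤ z})
      atTop (𝓝 ((gaussianReal 0 1).real (Set.Icc (-z) z))) := by
  obtain ⟨h1, h2, h3⟩ := trajLength_threshold_arith (sunShortTrajThreshold_pos (sunCoordι N) (sunCoordι_injective N))
    (sunWilsonForceSup_nonneg N d β) (sunWilsonForceLip_nonneg N d β) hn hε (rfl : sunWilsonTrajThreshold N d β = _) hτ
  exact wilson_sunLeapfrogHMCN_batchMeans_coverage N (suRep N) continuous_suRep β hε hn
    (measurable_halfKick_sun N (measurable_sunWilsonForce N β) ε) (halfKick_sunWilsonForce_nonneg N d β hε)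
    (norm_halfKick_sunWilsonForce_le N d β hε) (halfKickLip_sunWilsonForce_nonneg N d β hε)
    (norm_halfKick_sunWilsonForce_sub_le N d β hε) h1 h2 h3 hf hC hσ μ₀ ha hb' hz

end Wilson

end Summit.Ventures.LatticeQCDFlow.Scoring
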